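import Summits.ValiantsHypothesis.ValiantsHypothesis.Theorems.KPlusLogSqLawTropicalBTightnessThreshold
import Literature.Computability.AlgebraicComplexity.KV20NonRigidEquationsProofs

/-!
# Route «KPlusLogSqLaw», crux `TropicalB` (stmt-ValiantsHypothesis-19771) — `TropicalB` FORCES THE COUNTING-TIGHTNESS THRESHOLD TO BE
# LOGARITHMIC: `κ(m) < C₀·log₂ m`, and in the band `C₀·log₂ m ≤ K ≤ 2^(⌊log₂ m⌋/2)` chains miss all but a `2^{−K}` fraction of the slopes

HONEST FRAMING.  Companion of `…TropicalBTightnessThreshold` (same seat: val-sym-trop-p4 g12, cell `pub-symmetroid`, 2026-08-28;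
`--supports stmt-ValiantsHypothesis-19771 --as helper`), toward the registered stubs `stub_tropThin` / `stub_tropFat` of
`Cruxes/TropicalB/Lines/birth.lean`.  Every theorem here is a CONSEQUENCE OF `TropicalB` — taken as the hypothesis `hTB` in its UNSIGNED form
`∃ C, ∀ m K, TropRowD m K (2^(C(K + ⌊log₂ m⌋²)))`, which is EQUIVALENT to the crux (`tropicalB_iff_unsigned`, p444755, `C ↦ C+1`; stated
inline so that this file stays outside the route file's import cone) — i.e. a necessary condition / located test obtained from the crux by
slope-counting arithmetic; nothing is asserted about `TropicalB` itself, `WeakLifting`, DoorA26 / DoorA34, `MatrixDescartes`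
(stmt-ValiantsHypothesis-18050) or VP ≠ VNP.

CONTENT (`L = ⌊log₂ m⌋`, `a = ⌊L/2⌋`, `multichoose K m = C(m+K−1, m)` = the slope-counting ceiling on the number of chain terms).
* `two_pow_le_multichoose` (`1 ≤ K ≤ 2^a`, `4^a ≤ m` ⇒ `2^(a(K−1)) ≤ multichoose K m`, via the tree's
  `KumarVolk2020.succ_pow_le_choose`), `mul_two_mul_succ_le_two_pow` (`a(2a+1) ≤ 2^a`, `a ≥ 7`) — arithmetic.
* `tropRowD_div_of_tropicalB` — **`TropicalB` ⇒ ∃ C₀ ∀ m K, C₀ ≤ a → C₀·L ≤ K → K ≤ 2^a → TropRowD m K (multichoose K m / 2^K)`**: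
  in the band `C₀ log₂ m ≤ K ≤ 2^(⌊log₂ m⌋/2) ≈ √m` (inside the crux window) an unsigned dominant chain visits at most a `2^{−K}` fraction of
  the class multisets (`2^(C(K+L²) + K) ≤ 2^(a(K−1)) ≤ multichoose K m` once `a ≥ 18C+6`, `K ≥ (18C+6)L`; `C` = the constant of `hTB`).
* `tropRowD_notTight_of_tropicalB`, `tropRootLawAt_notTight_of_tropicalB` — **`TropicalB` ⇒ ∃ C₀ ∀ m K, C₀ ≤ a → C₀·L ≤ K →` the format
  `(m, K)` is NOT counting-tight** (unsigned `TropRowD m K (multichoose K m − 2)`, hence signed): the bottom of the band by the previous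
  theorem, everything above it by propagation of non-tightness in `K` (`Tightness.tropRowD_notTight_mono`, companion file).  In the
  threshold language of the companion file: **`TropicalB ⇒ κ(m) < C₀·log₂ m` for all `m ≥ 2^(2C₀)`**.

READING (located, not claimed).  The tropical `K + log² m` law does not merely ask for «O(1) bits per class» somewhere far out: it
predicts that the counting-tight column of the census (`κ(2) = 4`, `κ(3) = 4` located, `κ(4) ≥ 4`, `(5,4)`/`(6,4)` at `49/55`, `65/83`
and climbing) STOPS at `K = O(log m)` and that beyond it chains fall short of counting by a factor `≥ 2^K`.  Conversely a census trend
`κ(m) ≥ g(m)·log₂ m` with `g → ∞` (e.g. tight cells `(m, K)` with `K` growing linearly in `m`) is exactly what a refutation of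
`TropicalB` through counting-tight families would look like; by `Tightness.not_tropRowD_tight_of_le` it suffices to watch ONE cell per
size, the largest tight `K`.  The first cells that move `κ`: `(5,4)` (55 terms?), `(4,5)` (70?), `(5,5)` (126?).  [this file; arithmetic
over the cell's `tropicalB_iff_unsigned` and slope counting]
-/

set_option linter.dupNamespace false
set_option autoImplicit false

namespace Summit.ValiantsHypothesis.ValiantsHypothesis.Theorems.KPlusLogSqLaw

open Summit.ValiantsHypothesis.ValiantsHypothesis.Theorems.MatrixDescartes.Negative
open Summit.ValiantsHypothesis.ValiantsHypothesis.Theorems.LacunarySymmetroidMatrixDescartes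
open Summit.ValiantsHypothesis.ValiantsHypothesis.Theorems.LacunarySymmetroidMatrixDescartes.TropicalCensus
open scoped BigOperators
open Finset

namespace Tightness

variable {m K : ℕ}

/-! ### `TropicalB` forces the tightness threshold to be `O(log m)` -/

/-- A power lower bound for the number of class multisets: if `1 ≤ K ≤ 2^a` and `4^a ≤ m` then
`2^(a·(K−1)) ≤ multichoose K m = C(m+K−1, K−1)` (take `n = m / K ≥ 2^a` in the tree's `KumarVolk2020.succ_pow_le_choose`: `(n+1)^N ≤ C(M+N, N)` for `nN ≤ M`). [folklore] -/
theorem two_pow_le_multichoose (m K a : ℕ) (hK : 1 ≤ K) (hKa : K ≤ 2 ^ a) (hm : 2 ^ (2 * a) ≤ m) :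
    2 ^ (a * (K - 1)) ≤ Nat.multichoose K m := by
  have hn : 2 ^ a ≤ m / K := by
    rw [Nat.le_div_iff_mul_le hK]
    calc 2 ^ a * K ≤ 2 ^ a * 2 ^ a := Nat.mul_le_mul_left _ hKa
      _ = 2 ^ (2 * a) := by rw [← pow_add, two_mul]
      _ ≤ m := hm
  have h1 : (m / K + 1) ^ (K - 1) ≤ (m + (K - 1)).choose (K - 1) :=
    Literature.Computability.AlgebraicComplexity.KumarVolk2020.succ_pow_le_choose (m / K) (K - 1) m
      (calc m / K * (K - 1) ≤ m / K * K := Nat.mul_le_mul_left _ (Nat.sub_le _ _)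
        _ ≤ m := Nat.div_mul_le_self m K)
  have h2 : (m + (K - 1)).choose (K - 1) = Nat.multichoose K m := by
    rw [Nat.multichoose_eq]
    have : K + m - 1 = m + (K - 1) := by omega
    rw [this, Nat.choose_symm_add]
  calc 2 ^ (a * (K - 1)) = (2 ^ a) ^ (K - 1) := by rw [pow_mul]
    _ ≤ (m / K + 1) ^ (K - 1) := Nat.pow_le_pow_left (by omega) _
    _ ≤ (m + (K - 1)).choose (K - 1) := h1
    _ = Nat.multichoose K m := h2

/-- **`TropicalB` ⇒ NO COUNTING-TIGHT FORMAT IN THE BAND `C₀·log₂ m ≤ K ≤ 2^(⌊log₂ m⌋/2)` (`m` large), QUANTITATIVELY:** there the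
unsigned row is at most `multichoose K m / 2^K` — every dominant chain misses all but a `2^{-K}` fraction of the class multisets.
Proof: `hTB` gives the row `2^(C(K + log₂² m))`, and
`2^(C(K + log₂² m) + K) ≤ 2^(a(K−1)) ≤ multichoose K m` with `a = ⌊log₂ m⌋/2` once `a ≥ 18C + 6` and `K ≥ (18C+6)·log₂ m`. -/
theorem tropRowD_div_of_tropicalB (hTB : ∃ C : ℕ, ∀ m K : ℕ, TropRowD m K (2 ^ (C * (K + Nat.log 2 m ^ 2)))) :
    ∃ C₀ : ℕ, ∀ m K : ℕ, C₀ ≤ Nat.log 2 m / 2 → C₀ * Nat.log 2 m ≤ K → K ≤ 2 ^ (Nat.log 2 m / 2) →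
      TropRowD m K (Nat.multichoose K m / 2 ^ K) := by
  obtain ⟨C, hC⟩ := hTB
  refine ⟨18 * C + 6, fun m K ha hK hKa => ?_⟩
  set L := Nat.log 2 m with hL
  set a := L / 2 with haL
  have hL1 : L ≤ 2 * a + 1 := by omega
  have hL2 : 2 * a ≤ L := by omega
  have hm0 : m ≠ 0 := by
    rintro rfl
    simp [hL] at haL
    omega
  have hm : 2 ^ (2 * a) ≤ m :=
    (Nat.pow_le_pow_right (by norm_num) hL2).trans (hL ▸ Nat.pow_log_le_self 2 hm0)
  have hK1 : 1 ≤ K := by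
    have : 1 ≤ L := by omega
    nlinarith
  refine tropRowD_mono ?_ (hC m K)
  rw [Nat.le_div_iff_mul_le (by positivity)]
  -- arithmetic: `C·(K + L²) + K ≤ a·(K − 1)`
  have i1 : 3 * C * K ≤ a * K := Nat.mul_le_mul_right K (by omega)
  have i2 : 6 * K ≤ a * K := Nat.mul_le_mul_right K (by omega)
  have hK6 : 6 ≤ K := by
    have : 12 ≤ L := by omega
    nlinarith
  have i3 : 6 * a ≤ a * K := by nlinarith
  have i4 : 3 * C * L ^ 2 ≤ a * K := by
    have hL3 : L ≤ 3 * a := by omega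
    have h9 : 9 * C * L ≤ K := by nlinarith
    calc 3 * C * L ^ 2 = (3 * C * L) * L := by ring
      _ ≤ (3 * C * L) * (3 * a) := Nat.mul_le_mul_left _ hL3
      _ = a * (9 * C * L) := by ring
      _ ≤ a * K := Nat.mul_le_mul_left _ h9
  have harith : C * (K + L ^ 2) + K ≤ a * (K - 1) := by
    rw [Nat.mul_sub_one]
    have : 6 * (C * (K + L ^ 2) + K + a) ≤ 6 * (a * K) := by nlinarith
    omega
  calc 2 ^ (C * (K + L ^ 2)) * 2 ^ K = 2 ^ (C * (K + L ^ 2) + K) := (pow_add _ _ _).symm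
    _ ≤ 2 ^ (a * (K - 1)) := Nat.pow_le_pow_right (by norm_num) harith
    _ ≤ Nat.multichoose K m := two_pow_le_multichoose m K a hK1 hKa hm

/-- `a·(2a+1) ≤ 2^a` for `a ≥ 7` (so that the band of `tropRowD_div_of_tropicalB` is nonempty). [arithmetic] -/
theorem mul_two_mul_succ_le_two_pow {a : ℕ} (ha : 7 ≤ a) : a * (2 * a + 1) ≤ 2 ^ a := by
  induction a, ha using Nat.le_induction with
  | base => norm_num
  | succ a ha ih =>
    have h4 : 4 * a + 3 ≤ a * (2 * a + 1) := by nlinarith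
    calc (a + 1) * (2 * (a + 1) + 1) = a * (2 * a + 1) + (4 * a + 3) := by ring
      _ ≤ 2 ^ a + 2 ^ a := Nat.add_le_add ih (h4.trans ih)
      _ = 2 ^ (a + 1) := by ring

/-- **`TropicalB` ⇒ the tightness threshold is logarithmic:** for some absolute `C₀`, no format with `⌊log₂ m⌋ ≥ 2C₀` and
`K ≥ C₀·⌊log₂ m⌋` carries a counting-tight chain (unsigned, hence also signed) — at the bottom of the band this is the quantitative
bound `tropRowD_div_of_tropicalB`, above the band it is propagation of non-tightness in `K` (`tropRowD_notTight_mono`).  In the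
language of the docstring: `TropicalB ⇒ κ(m) < C₀·log₂ m` for all large `m`. -/
theorem tropRowD_notTight_of_tropicalB (hTB : ∃ C : ℕ, ∀ m K : ℕ, TropRowD m K (2 ^ (C * (K + Nat.log 2 m ^ 2)))) :
    ∃ C₀ : ℕ, ∀ m K : ℕ, C₀ ≤ Nat.log 2 m / 2 → C₀ * Nat.log 2 m ≤ K →
      TropRowD m K (Nat.multichoose K m - 2) := by
  obtain ⟨C₀, hC₀⟩ := tropRowD_div_of_tropicalB hTB
  refine ⟨max C₀ 7, fun m K ha hK => ?_⟩
  set L := Nat.log 2 m with hL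
  set a := L / 2 with haL
  have ha7 : 7 ≤ a := le_trans (le_max_right _ _) ha
  have haC : C₀ ≤ a := le_trans (le_max_left _ _) ha
  have hL1 : L ≤ 2 * a + 1 := by omega
  have hL2 : 2 * a ≤ L := by omega
  have hm0 : m ≠ 0 := by
    rintro rfl
    simp [hL] at haL
    omega
  have hm : 2 ^ (2 * a) ≤ m :=
    (Nat.pow_le_pow_right (by norm_num) hL2).trans (hL ▸ Nat.pow_log_le_self 2 hm0)
  -- the bottom of the band
  set K₁ := max C₀ 7 * L with hK₁
  have hK₁a : K₁ ≤ 2 ^ a :=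
    calc K₁ ≤ a * L := Nat.mul_le_mul_right L ha
      _ ≤ a * (2 * a + 1) := Nat.mul_le_mul_left a hL1
      _ ≤ 2 ^ a := mul_two_mul_succ_le_two_pow ha7
  have hK₁2 : 2 ≤ K₁ := by
    have : 7 * 14 ≤ K₁ := by
      calc 7 * 14 ≤ max C₀ 7 * (2 * a) := Nat.mul_le_mul (le_max_right _ _) (by omega)
        _ ≤ max C₀ 7 * L := Nat.mul_le_mul_left _ hL2
    omega
  have hrow₁ : TropRowD m K₁ (Nat.multichoose K₁ m / 2 ^ K₁) :=
    hC₀ m K₁ haC ((Nat.mul_le_mul_right L (le_max_left C₀ 7)).trans le_rfl) hK₁a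
  have hN : 4 ≤ Nat.multichoose K₁ m := by
    have h := two_pow_le_multichoose m K₁ a (by omega) hK₁a hm
    have h7 : 2 ^ 7 ≤ 2 ^ (a * (K₁ - 1)) :=
      Nat.pow_le_pow_right (by norm_num)
        (calc 7 = 7 * 1 := by norm_num
          _ ≤ a * (K₁ - 1) := Nat.mul_le_mul ha7 (by omega))
    have : (2 : ℕ) ^ 7 = 128 := by norm_num
    omega
  have htight₁ : TropRowD m K₁ (Nat.multichoose K₁ m - 2) := by
    refine tropRowD_mono ?_ hrow₁
    have h2 : Nat.multichoose K₁ m / 2 ^ K₁ ≤ Nat.multichoose K₁ m / 2 :=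
      Nat.div_le_div_left (by calc 2 = 2 ^ 1 := by norm_num
                                 _ ≤ 2 ^ K₁ := Nat.pow_le_pow_right (by norm_num) (by omega)) (by norm_num)
    omega
  exact tropRowD_notTight_mono hK₁2 hK htight₁

/-- Signed reading of the same: under `TropicalB`, for `⌊log₂ m⌋ ≥ 2C₀` and `K ≥ C₀·⌊log₂ m⌋` no SIGN-ALTERNATING dominant chain of any
design of format `(m, K)` is counting-tight (`TropRootLawAt m K (multichoose K m − 2)`). -/
theorem tropRootLawAt_notTight_of_tropicalB (hTB : ∃ C : ℕ, ∀ m K : ℕ, TropRowD m K (2 ^ (C * (K + Nat.log 2 m ^ 2)))) :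
    ∃ C₀ : ℕ, ∀ m K : ℕ, C₀ ≤ Nat.log 2 m / 2 → C₀ * Nat.log 2 m ≤ K →
      TropRootLawAt m K (Nat.multichoose K m - 2) := by
  obtain ⟨C₀, hC₀⟩ := tropRowD_notTight_of_tropicalB hTB
  exact ⟨C₀, fun m K ha hK => tropRootLawAt_of_tropRowD (hC₀ m K ha hK)⟩

end Tightness

end Summit.ValiantsHypothesis.ValiantsHypothesis.Theorems.KPlusLogSqLaw
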